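import Literature.Topology.FourManifolds.TautFoliationsConePosition
import HarnessLib

/-!
# Cone positions keeping the map on prescribed interior edges

Sibling of `TautFoliationsConePosition.lean`. The taming of the 1-skeleton
(`IsTransverselyOriented.exists_tame_skeleton`) modifies the map on every interior edge. Here
is the **relative version**: on a prescribed family of interior edges along which the heights
of the map are already tame, the skeleton map can be taken equal to the map itself
(`exists_tame_skeleton_rel`), whence a cone position whose skeleton equals the map on all the
edges contained in a prescribed region on whose edges the heights of the map are tame in every
flow box (`nonempty_conePosition_rel`). This is used to cone a disc whose collar is a fence
(heights constant along the rings, monotone along the radii), keeping the fence structure on the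
collar 1-skeleton.

* `IsTransverselyOriented.exists_tame_skeleton_rel`, `IsTransverselyOriented.nonempty_conePosition_rel`
  (**proved**; the proofs follow the absolute versions).

All statements are [folklore] refinements of [cite: CamachoLinsNeto1985, Ch. VI §3 Prop. 1].
-/

noncomputable section

open Set Filter Metric Topology Function

namespace Literature.Topology.FourManifolds

namespace Foliation

open SquareGrid SquareGrid.Grid

variable {B : Type*} [NormedAddCommGroup B] [NormedSpace ℝ B] {M : Type*} [TopologicalSpace M]
variable (F : Foliation B M) {ρ : ℝ}

variable {F} in
/-- **Taming the 1-skeleton, relative version**: as `exists_tame_skeleton`, keeping `f` on the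
owned edges of `Keep` (along which the heights of `f` are tame). [cite: CamachoLinsNeto1985, Ch. VI §3 Prop. 1] -/
theorem IsTransverselyOriented.exists_tame_skeleton_rel (ho : F.IsTransverselyOriented) (g : Grid)
    {box : Fin g.n × Fin g.n → OpenPartialHomeomorph M (B × ℝ)} (hbox : ∀ q, box q ∈ F.atlas)
    (hρ : 0 < ρ) {f : ℝ × ℝ → M} (hf : ContinuousOn f g.S)
    (hsrc : ∀ q q', g.Adj q q' → subbox (box q) (box q (f (g.centre q))) ρ ⊆ (box q').source)
    (hf4 : ∀ q q', g.Adj q q' → ∀ x ∈ g.sq q',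
      f x ∈ subbox (box q) (box q (f (g.centre q))) (ρ / 4))
    (hbd : ∀ q k, g.IsBoundaryEdge q k →
      TameFunction.IsTameOn (fun s ↦ height (box q) (f (g.edge q k s))) 0 (2 * g.ℓ))
    (Keep : g.OwnedEdge → Prop)
    (hkeep : ∀ E, Keep E → TameFunction.IsTameOn (fun s ↦ height (box E.q) (f (g.edge E.q E.k s))) 0 (2 * g.ℓ)) :
    ∃ g₁ : ℝ × ℝ → M,
      (∀ E, Keep E → ∀ s ∈ Icc 0 (2 * g.ℓ), g₁ (g.edge E.q E.k s) = f (g.edge E.q E.k s)) ∧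
      (∀ q k, g.IsBoundaryEdge q k → ∀ s ∈ Icc 0 (2 * g.ℓ), g₁ (g.edge q k s) = f (g.edge q k s)) ∧
      (∀ q, ContinuousOn g₁ (sphere (g.centre q) g.ℓ)) ∧
      (∀ q k, ∀ s ∈ Icc 0 (2 * g.ℓ),
        g₁ (g.edge q k s) ∈ subbox (box q) (box q (f (g.centre q))) (ρ / 2)) ∧
      (∀ q k, TameFunction.IsTameOn (fun s ↦ height (box q) (g₁ (g.edge q k s))) 0 (2 * g.ℓ)) := by
  have h2ℓ : (0 : ℝ) ≤ 2 * g.ℓ := by linarith [g.hℓ]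
  -- the modification on each owned edge
  have hmod : ∀ E : g.OwnedEdge, ∃ μ : ℝ → M, ContinuousOn μ (Icc 0 (2 * g.ℓ)) ∧
      μ 0 = f (g.edge E.q E.k 0) ∧ μ (2 * g.ℓ) = f (g.edge E.q E.k (2 * g.ℓ)) ∧
      (∀ s ∈ Icc 0 (2 * g.ℓ), μ s ∈ subbox (box E.q) (box E.q (f (g.centre E.q))) (ρ / 2)) ∧
      (∀ s ∈ Icc 0 (2 * g.ℓ),
        μ s ∈ subbox (box E.other) (box E.other (f (g.centre E.other))) (ρ / 2)) ∧
      TameFunction.IsTameOn (fun s ↦ height (box E.q) (μ s)) 0 (2 * g.ℓ) ∧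
      (Keep E → μ = fun s ↦ f (g.edge E.q E.k s)) := by
    intro E
    have hc : ContinuousOn (fun s ↦ f (g.edge E.q E.k s)) (Icc 0 (2 * g.ℓ)) :=
      hf.comp (g.continuous_edge E.q E.k).continuousOn fun s hs ↦ g.sq_subset_S _ (g.edge_mem_sq E.q E.k hs)
    have hq4 : ∀ s ∈ Icc 0 (2 * g.ℓ), f (g.edge E.q E.k s) ∈ subbox (box E.q) (box E.q (f (g.centre E.q))) (ρ / 4) :=
      fun s hs ↦ hf4 E.q E.q (g.adj_refl _) _ (g.edge_mem_sq E.q E.k hs)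
    have ho2 : ∀ s ∈ Icc 0 (2 * g.ℓ), f (g.edge E.q E.k s) ∈ subbox (box E.other) (box E.other (f (g.centre E.other))) (ρ / 2) :=
      fun s hs ↦ subbox_mono _ _ (by linarith) (hf4 E.other E.q E.adj_other.symm _ (g.edge_mem_sq E.q E.k hs))
    by_cases hK : Keep E
    · exact ⟨fun s ↦ f (g.edge E.q E.k s), hc, rfl, rfl, fun s hs ↦ subbox_mono _ _ (by linarith) (hq4 s hs), ho2,
        hkeep E hK, fun _ ↦ rfl⟩
    · obtain ⟨μ, h1, h2, h3, h4, h5, h6⟩ := F.exists_tame_modification (hbox E.q) (hbox E.other) h2ℓ hρ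
        (c := fun s ↦ f (g.edge E.q E.k s)) hc hq4 ho2
      exact ⟨μ, h1, h2, h3, h4, h5, h6, fun h ↦ absurd h hK⟩
  choose μ hμc hμ0 hμ1 hμq hμo hμt hμkeep using hmod
  have hends : ∀ E : g.OwnedEdge, ∀ s, s = 0 ∨ s = 2 * g.ℓ → μ E s = f (g.edge E.q E.k s) := by
    rintro E s (rfl | rfl)
    exacts [hμ0 E, hμ1 E]
  -- the chosen edge and parameter through a point of the owned skeleton
  have hchoice : ∀ x : ℝ × ℝ, (∃ E : g.OwnedEdge, x ∈ E.seg) →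
      ∃ (E : g.OwnedEdge) (s : ℝ), s ∈ Icc 0 (2 * g.ℓ) ∧ g.edge E.q E.k s = x :=
    fun x ⟨E, s, hs, h⟩ ↦ ⟨E, s, hs, h⟩
  choose Eof sof hsof hEof using hchoice
  classical
  set g₁ : ℝ × ℝ → M := fun x ↦ if h : ∃ E : g.OwnedEdge, x ∈ E.seg then μ (Eof x h) (sof x h) else f x
    with hg₁
  -- `g₁` on an owned edge is its modification
  have key : ∀ E : g.OwnedEdge, ∀ s ∈ Icc 0 (2 * g.ℓ), g₁ (g.edge E.q E.k s) = μ E s := by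
    intro E s hs
    have hex : ∃ E' : g.OwnedEdge, g.edge E.q E.k s ∈ E'.seg := ⟨E, mem_image_of_mem _ hs⟩
    rw [hg₁]
    simp only [dif_pos hex]
    have hs' := hsof _ hex
    have heq := hEof _ hex
    generalize Eof _ hex = E' at hs' heq ⊢
    generalize sof _ hex = s' at hs' heq ⊢
    by_cases hEE : E' = E
    · subst hEE
      rw [g.edge_injective _ _ heq]
    · rw [hends E' s' (OwnedEdge.endpoint_of_ne hEE hs' hs heq),
        hends E s (OwnedEdge.endpoint_of_ne (Ne.symm hEE) hs hs' heq.symm), heq]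
  -- `g₁ = f` on boundary edges
  have hbdry : ∀ q k, g.IsBoundaryEdge q k → ∀ s ∈ Icc 0 (2 * g.ℓ),
      g₁ (g.edge q k s) = f (g.edge q k s) := by
    intro q k hb s hs
    rw [hg₁]
    simp only
    split_ifs with hex
    · have hs' := hsof _ hex
      have heq := hEof _ hex
      generalize Eof _ hex = E' at hs' heq ⊢
      generalize sof _ hex = s' at hs' heq ⊢
      rw [hends E' s' (OwnedEdge.endpoint_of_isBoundaryEdge hb hs hs' heq), heq]
    · rfl
  -- on each side of each square, `g₁` is a nice curve
  have hside : ∀ q k, ∃ ν : ℝ → M, (∀ s ∈ Icc 0 (2 * g.ℓ), g₁ (g.edge q k s) = ν s) ∧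
      ContinuousOn ν (Icc 0 (2 * g.ℓ)) ∧
      (∀ s ∈ Icc 0 (2 * g.ℓ), ν s ∈ subbox (box q) (box q (f (g.centre q))) (ρ / 2)) ∧
      TameFunction.IsTameOn (fun s ↦ height (box q) (ν s)) 0 (2 * g.ℓ) := by
    intro q k
    rcases g.side_cases q k with hb | ⟨h, rfl⟩ | ⟨h, rfl⟩ | ⟨h, rfl⟩ | ⟨h, rfl⟩
    · -- boundary edge: unchanged
      refine ⟨fun s ↦ f (g.edge q k s), hbdry q k hb, ?_, fun s hs ↦ ?_, hbd q k hb⟩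
      · exact hf.comp (g.continuous_edge q k).continuousOn
          fun s hs ↦ g.sq_subset_S _ (g.edge_mem_sq q k hs)
      · exact subbox_mono _ _ (by linarith) (hf4 q q (g.adj_refl _) _ (g.edge_mem_sq q k hs))
    · -- owned bottom edge
      exact ⟨μ (g.ownedBottom q h), key (g.ownedBottom q h), hμc _, hμq (g.ownedBottom q h),
        hμt (g.ownedBottom q h)⟩
    · -- owned left edge
      exact ⟨μ (g.ownedLeft q h), key (g.ownedLeft q h), hμc _, hμq (g.ownedLeft q h),
        hμt (g.ownedLeft q h)⟩
    · -- top edge: owned by the square above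
      set E : g.OwnedEdge := g.ownedBottom (g.up q h) (Nat.succ_pos _) with hE
      have hoth : E.other = q := g.other_ownedBottom_up q h
      have hsub : subbox (box E.q) (box E.q (f (g.centre E.q))) (ρ / 2) ⊆ (box q).source := by
        refine (subbox_mono _ _ (show ρ / 2 ≤ ρ by linarith)).trans ?_
        have := hsrc E.q E.other E.adj_other
        rwa [hoth] at this
      refine ⟨μ E, fun s hs ↦ ?_, hμc E, fun s hs ↦ ?_, ?_⟩
      · rw [g.edge_one_eq_edge_up q h]
        exact key E s hs
      · have := hμo E s hs
        rwa [hoth] at this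
      · exact ho.isTameOn_height_of_subbox (hbox E.q) (hbox q) hsub (hμq E) (hμt E)
    · -- right edge: owned by the square to the right
      set E : g.OwnedEdge := g.ownedLeft (g.right q h) (Nat.succ_pos _) with hE
      have hoth : E.other = q := g.other_ownedLeft_right q h
      have hsub : subbox (box E.q) (box E.q (f (g.centre E.q))) (ρ / 2) ⊆ (box q).source := by
        refine (subbox_mono _ _ (show ρ / 2 ≤ ρ by linarith)).trans ?_
        have := hsrc E.q E.other E.adj_other
        rwa [hoth] at this
      refine ⟨μ E, fun s hs ↦ ?_, hμc E, fun s hs ↦ ?_, ?_⟩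
      · rw [g.edge_three_eq_edge_right q h]
        exact key E s hs
      · have := hμo E s hs
        rwa [hoth] at this
      · exact ho.isTameOn_height_of_subbox (hbox E.q) (hbox q) hsub (hμq E) (hμt E)
  choose ν hν hνc hνsub hνt using hside
  refine ⟨g₁, fun E hE s hs ↦ ?_, hbdry, fun q ↦ ?_, fun q k s hs ↦ (hν q k s hs).symm ▸ hνsub q k s hs, fun q k ↦
    (hνt q k).congr fun s hs ↦ congrArg (height (box q)) (hν q k s hs).symm⟩
  · rw [key E s hs, hμkeep E hE]
  -- continuity on the boundary of a square: on each closed side, `g₁ = ν ∘ edgeParam`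
  rw [g.sphere_centre_eq_iUnion q]
  refine LocallyFinite.continuousOn_iUnion (locallyFinite_of_finite _)
    (fun k ↦ (isCompact_Icc.image (g.continuous_edge q k)).isClosed) fun k ↦ ?_
  have hcomp : ContinuousOn (fun x ↦ ν q k (g.edgeParam q k x)) (g.edge q k '' Icc 0 (2 * g.ℓ)) := by
    refine (hνc q k).comp (g.continuous_edgeParam q k).continuousOn ?_
    rintro _ ⟨s, hs, rfl⟩
    rwa [g.edgeParam_edge]
  refine hcomp.congr ?_
  rintro _ ⟨s, hs, rfl⟩
  show g₁ _ = ν q k (g.edgeParam q k (g.edge q k s))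
  rw [g.edgeParam_edge]
  exact hν q k s hs

/-! ## The relative cone position -/

section Package

variable {c₀ : ℝ × ℝ} {L : ℝ} {f : ℝ × ℝ → M}

/-- **Existence of a cone position keeping the map on the edges inside a region `T`** along
which the heights of the map are tame in every flow box. [cite: CamachoLinsNeto1985, Ch. VI §3 Prop. 1] -/
theorem IsTransverselyOriented.nonempty_conePosition_rel [ProperSpace B] [T2Space M]
    (ho : F.IsTransverselyOriented) (hL : 0 < L)
    (hf : ContinuousOn f (closedBall c₀ L)) (T : Set (ℝ × ℝ))
    (hbd : ∀ (n : ℕ) (hn : 0 < n), ∀ e ∈ F.atlas, ∀ q k, (grid c₀ hL hn).IsBoundaryEdge q k →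
      (∀ s ∈ Icc 0 (2 * (grid c₀ hL hn).ℓ), f ((grid c₀ hL hn).edge q k s) ∈ e.source) →
      TameFunction.IsTameOn (fun s ↦ height e (f ((grid c₀ hL hn).edge q k s))) 0 (2 * (grid c₀ hL hn).ℓ))
    (hT : ∀ (n : ℕ) (hn : 0 < n), ∀ e ∈ F.atlas, ∀ q k, (grid c₀ hL hn).edge q k '' Icc 0 (2 * (grid c₀ hL hn).ℓ) ⊆ T →
      (∀ s ∈ Icc 0 (2 * (grid c₀ hL hn).ℓ), f ((grid c₀ hL hn).edge q k s) ∈ e.source) →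
      TameFunction.IsTameOn (fun s ↦ height e (f ((grid c₀ hL hn).edge q k s))) 0 (2 * (grid c₀ hL hn).ℓ)) :
    ∃ P : ConePosition F f c₀ hL, ∀ q k, P.gr.edge q k '' Icc 0 (2 * P.gr.ℓ) ⊆ T →
      ∀ s ∈ Icc 0 (2 * P.gr.ℓ), P.skel (P.gr.edge q k s) = f (P.gr.edge q k s) := by
  obtain ⟨n, hn, box, ρ, hρ, hbox, hsrc, hf4⟩ := F.exists_boxes hL hf
  have hf' : ContinuousOn f (grid c₀ hL hn).S := by rwa [grid_S]
  set g := grid c₀ hL hn with hg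
  have hsrc_edge : ∀ q k, ∀ s ∈ Icc 0 (2 * g.ℓ), f (g.edge q k s) ∈ (box q).source := fun q k s hs ↦
    F.subbox_subset_source (hbox q) (hf4 q q (g.adj_refl q) _ (g.edge_mem_sq q k hs))
  obtain ⟨g₁, h₀, h₁, h₂, h₃, h₄⟩ := ho.exists_tame_skeleton_rel g hbox hρ hf' hsrc hf4
    (fun q k hb ↦ hbd n hn (box q) (hbox q) q k hb (hsrc_edge q k))
    (fun E ↦ E.seg ⊆ T) (fun E hE ↦ hT n hn (box E.q) (hbox E.q) E.q E.k hE (hsrc_edge E.q E.k))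
  refine ⟨⟨n, hn, box, ρ, g₁, hρ, hbox, hsrc, hf4, h₁, h₂, h₃, h₄⟩, fun q k hqk s hs ↦ ?_⟩
  show g₁ (g.edge q k s) = f (g.edge q k s)
  rcases g.side_cases q k with hb | ⟨h, rfl⟩ | ⟨h, rfl⟩ | ⟨h, rfl⟩ | ⟨h, rfl⟩
  · exact h₁ q k hb s hs
  · exact h₀ (g.ownedBottom q h) hqk s hs
  · exact h₀ (g.ownedLeft q h) hqk s hs
  · rw [g.edge_one_eq_edge_up q h] at hqk ⊢
    exact h₀ (g.ownedBottom (g.up q h) (Nat.succ_pos _)) hqk s hs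
  · rw [g.edge_three_eq_edge_right q h] at hqk ⊢
    exact h₀ (g.ownedLeft (g.right q h) (Nat.succ_pos _)) hqk s hs

end Package

end Foliation

end Literature.Topology.FourManifolds
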